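import Mathlib
import Literature.Analysis.FluidPDE.NormalisedPressureSupBound
import Literature.Analysis.FluidPDE.NormalisedPressureAffine
import Literature.Analysis.FluidPDE.SpaceTimeRescaling
import Literature.Analysis.FluidPDE.LipschitzSqIntegrableDecay
import Literature.Analysis.FluidPDE.NormalisedPressureDischarge
import Literature.Analysis.FluidPDE.NormalisedPressureLpClass
import Literature.Analysis.FluidPDE.HarmonicLiouvilleLp
import Literature.Analysis.FluidPDE.LerayProfileCalculus
import Literature.Analysis.FluidPDE.TaoEnstrophyLocalisationProofs
import Literature.Analysis.FluidPDE.TaoEnergyLocalisation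
import Literature.Analysis.FluidPDE.TaoLocalisationHolds
import Literature.Analysis.FluidPDE.SereginSverakPressureMonotone
import Summits.NavierStokesRegularity.NavierStokesRegularity.Theorems.TypeICertificateLadderRungReynoldsOneTaoCover
import Summits.NavierStokesRegularity.NavierStokesRegularity.Theorems.BernoulliDecelerationHeadMaxPointLemma
import Summits.NavierStokesRegularity.NavierStokesRegularity.Theorems.SwallowedContinuumEndpointMapExists
import Summits.NavierStokesRegularity.NavierStokesRegularity.Theses.BernoulliDeceleration
import HarnessLib

/-!
# `BernoulliDeceleration.HeadPeaksDecelerate` (item stmt-NavierStokesRegularity-3037)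

Support statement (B) of the route `BernoulliDeceleration`: for a classical Leray–Hopf solution of
unforced Navier–Stokes on `[0, T) × ℝ³` (`ν > 0`) from a rapidly decaying datum, if the modified
head `Π̃(t, ·) = |u(t)|²/2 + p̃[u(t)]` (`p̃` = `normalisedPressure`) is positive somewhere at a time
`t ∈ [0, T)`, then it attains its maximum at a point `y` where `∂ₜ|u|² ≤ −2ν|ω|²`.

Proof (Seregin–Šverák 2002, §1, in the tree's vocabulary):

* `Π̃(t, ·)` is continuous and tends to `0` at spatial infinity: `u(t) → 0` (Lipschitz and square
  integrable on the sub-slab `[0, (t+T)/2]`, Tao's class) and `p̃[u(t)] → 0`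
  (`HeadPeaks.tendsto_normalisedPressure_cocompact`, a zoom-out argument: the sup bound
  `|p̃[w](0)| ≤ M₀²/3 + 8M₀M₁ + ‖w‖₂²/(2π)` applied to `w(y) = γ v(x₀ + γ y)`, for which
  `p̃[w](0) = γ² p̃[v](x₀)` and `‖w‖₂² = ‖v‖₂²/γ`). Hence a positive value forces a global maximum.
* the pressure of the classical solution is the normalised pressure up to a constant at EVERY time
  of `[0, T)` (`HeadPeaks.pressure_eq_normalisedPressure_add_const`): Tao's theory provides a
  pressure `q` with `(u, q)` in Tao's class on `[0, T']`; the two momentum equations for the same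
  velocity give `∇p = ∇q`, and `q(t) − p̃[u(t)]` is harmonic (both Laplacians equal
  `−tr((∇u)²)`) and square integrable, hence zero (`eq_zero_of_harmonic_memLp`).
* at the maximiser the head `|u|²/2 + p` has a local maximum, and item (A)
  (`bernoulliDeceleration_headMaxPointLemma_proof`) gives `∂ₜ|u|² ≤ −2ν|ω|²` there.
-/

noncomputable section

set_option linter.dupNamespace false

namespace Summit.NavierStokesRegularity.NavierStokesRegularity.Theorems

open MeasureTheory Set Filter Topology Metric Function Laplacian InnerProductSpace
  Literature.Analysis.FluidPDE
open scoped NNReal ENNReal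

namespace HeadPeaks

variable {ν T : ℝ} {u : ℝ → EuclideanSpace ℝ (Fin 3) → EuclideanSpace ℝ (Fin 3)}
  {p q : ℝ → EuclideanSpace ℝ (Fin 3) → ℝ}

/-- A bounded field of finite energy is in `L⁴` (`|v|⁴ ≤ B²|v|²`). [folklore] -/
theorem memLp_four_of_norm_le {v : EuclideanSpace ℝ (Fin 3) → EuclideanSpace ℝ (Fin 3)}
    (hv : Continuous v) (hE : (∫⁻ x, ‖v x‖ₑ ^ 2) < ⊤) {B : ℝ} (hB : ∀ x, ‖v x‖ ≤ B) :
    MemLp v 4 volume := by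
  refine ⟨hv.aestronglyMeasurable, ?_⟩
  rw [eLpNorm_lt_top_iff_lintegral_rpow_enorm_lt_top (by norm_num) (by norm_num)]
  have h4 : ((4 : ℝ≥0∞).toReal) = ((4 : ℕ) : ℝ) := by norm_num
  simp_rw [h4, ENNReal.rpow_natCast]
  have hpt : ∀ x, ‖v x‖ₑ ^ 4 ≤ ENNReal.ofReal B ^ 2 * ‖v x‖ₑ ^ 2 := by
    intro x
    have h1 : ‖v x‖ₑ ≤ ENNReal.ofReal B := by
      rw [← ofReal_norm]
      exact ENNReal.ofReal_le_ofReal (hB x)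
    calc ‖v x‖ₑ ^ 4 = ‖v x‖ₑ ^ 2 * ‖v x‖ₑ ^ 2 := by ring
      _ ≤ ENNReal.ofReal B ^ 2 * ‖v x‖ₑ ^ 2 := by gcongr
  calc ∫⁻ x, ‖v x‖ₑ ^ 4 ≤ ∫⁻ x, ENNReal.ofReal B ^ 2 * ‖v x‖ₑ ^ 2 := lintegral_mono hpt
    _ = ENNReal.ofReal B ^ 2 * ∫⁻ x, ‖v x‖ₑ ^ 2 :=
        lintegral_const_mul' _ _ (ENNReal.pow_ne_top ENNReal.ofReal_ne_top)
    _ < ⊤ := ENNReal.mul_lt_top (ENNReal.pow_lt_top ENNReal.ofReal_lt_top) hE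

/-- **The normalised pressure of a Lipschitz field of finite energy vanishes at infinity.**
Zoom-out argument: for `w(y) = γ v(x₀ + γ y)` one has `p̃[w](0) = γ² p̃[v](x₀)`,
`‖w‖₂² = ‖v‖₂²/γ`, `‖∇w‖ ≤ γ²L`, and `|w| ≤ γ sup_{B(x₀, γ)} |v|` on the unit ball, so the sup
bound `|p̃[w](0)| ≤ M₀²/3 + 8M₀M₁ + ‖w‖₂²/(2π)` gives
`|p̃[v](x₀)| ≤ m²/3 + 8γLm + ‖v‖₂²/(2πγ³)`, `m = sup_{B(x₀, γ)} |v| → 0` as `|x₀| → ∞`.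
[cite: Tao2011, Lemma 4.1 (i), context] -/
theorem tendsto_normalisedPressure_cocompact
    {v : EuclideanSpace ℝ (Fin 3) → EuclideanSpace ℝ (Fin 3)} (hv : ContDiff ℝ 1 v)
    (hE : (∫⁻ x, ‖v x‖ₑ ^ 2) < ⊤) {L : ℝ≥0} (hlip : LipschitzWith L v) :
    Tendsto (normalisedPressure v) (cocompact (EuclideanSpace ℝ (Fin 3))) (𝓝 0) := by
  have hv2 : Integrable fun y => ‖v y‖ ^ 2 :=
    integrable_sq_of_lintegral_enorm_sq_lt_top hv.continuous hE
  have hv0 : Tendsto v (cocompact _) (𝓝 0) :=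
    tendsto_cocompact_of_lipschitzWith_of_integrable_sq hlip hv2
  set I : ℝ := ∫ y, ‖v y‖ ^ 2 with hI
  have hI0 : 0 ≤ I := integral_nonneg fun _ => by positivity
  have hL0 : (0 : ℝ) ≤ L := L.coe_nonneg
  have hπ := Real.pi_pos
  rw [Metric.tendsto_nhds]
  intro ε hε
  -- the zoom-out scale `γ ≥ 1` with `I / (2π γ³) ≤ ε / 3`
  obtain ⟨γ, hγ1, hγI⟩ : ∃ γ : ℝ, 1 ≤ γ ∧ I / (2 * Real.pi * γ ^ 3) ≤ ε / 3 := by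
    refine ⟨max 1 (3 * I / (2 * Real.pi * ε)), le_max_left _ _, ?_⟩
    set γ := max 1 (3 * I / (2 * Real.pi * ε)) with hγdef
    have hγ1 : 1 ≤ γ := le_max_left _ _
    have hγ0 : 0 < γ := by linarith
    have h3 : 3 * I ≤ γ * (2 * Real.pi * ε) :=
      (div_le_iff₀ (by positivity)).1 (le_max_right _ _)
    have hγ3 : γ ≤ γ ^ 3 := by
      calc γ = γ * 1 * 1 := by ring
        _ ≤ γ * γ * γ := by gcongr
        _ = γ ^ 3 := by ring
    calc I / (2 * Real.pi * γ ^ 3) ≤ I / (2 * Real.pi * γ) := by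
          apply div_le_div_of_nonneg_left hI0 (by positivity)
          gcongr
      _ ≤ ε / 3 := by
          rw [div_le_div_iff₀ (by positivity) (by norm_num)]
          nlinarith [h3]
  have hγ : 0 < γ := by linarith
  -- the smallness threshold `δ`
  set K : ℝ := 1 / 3 + 8 * γ * L with hK
  have hK0 : 0 < K := by positivity
  set δ : ℝ := min 1 (ε / (3 * K)) with hδ
  have hδ0 : 0 < δ := lt_min one_pos (by positivity)
  have hδ1 : δ ≤ 1 := min_le_left _ _
  have hδK : δ * K ≤ ε / 3 := by
    have h : δ ≤ ε / (3 * K) := min_le_right _ _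
    rw [le_div_iff₀ (by positivity)] at h
    linarith
  -- `‖v‖ < δ` outside a ball
  obtain ⟨R, hR⟩ : ∃ R : ℝ, ∀ y, R < ‖y‖ → ‖v y‖ < δ := by
    obtain ⟨Kc, hKc, hKv⟩ :=
      (hasBasis_cocompact.eventually_iff).1 (Metric.tendsto_nhds.1 hv0 δ hδ0)
    obtain ⟨R, hR⟩ := hKc.isBounded.subset_closedBall 0
    refine ⟨R, fun y hy => ?_⟩
    have hy' : y ∈ Kcᶜ := fun h' => not_le.2 hy (mem_closedBall_zero_iff.1 (hR h'))
    have h := hKv hy'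
    rwa [dist_zero_right] at h
  -- conclusion outside the ball of radius `R + γ`
  have hmem : (closedBall (0 : EuclideanSpace ℝ (Fin 3)) (R + γ))ᶜ ∈ cocompact _ :=
    (isCompact_closedBall _ _).compl_mem_cocompact
  filter_upwards [hmem] with x₀ hx₀
  rw [mem_compl_iff, mem_closedBall_zero_iff, not_le] at hx₀
  rw [dist_zero_right, Real.norm_eq_abs]
  -- the zoomed-out field `w(y) = γ v(x₀ + γ y)`
  set w : EuclideanSpace ℝ (Fin 3) → EuclideanSpace ℝ (Fin 3) := fun y => γ • v (x₀ + γ • y)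
    with hw
  have hA : ContDiff ℝ 1 fun y : EuclideanSpace ℝ (Fin 3) => x₀ + γ • y :=
    contDiff_const.add (contDiff_id.const_smul γ)
  have hw1 : ContDiff ℝ 1 w := (hv.comp hA).const_smul γ
  -- energy of `w`
  have hγv : ∫⁻ x, ‖γ • v x‖ₑ ^ 2 = ENNReal.ofReal (γ ^ 2) * ∫⁻ x, ‖v x‖ₑ ^ 2 := by
    rw [← lintegral_const_mul' _ _ ENNReal.ofReal_ne_top]
    refine lintegral_congr fun x => ?_
    rw [enorm_smul, mul_pow, Real.enorm_eq_ofReal hγ.le, ENNReal.ofReal_pow hγ.le]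
  have hwE : (∫⁻ y, ‖w y‖ₑ ^ 2) < ⊤ := by
    have h := lintegral_comp_space_affine hγ x₀ (fun x => ‖γ • v x‖ₑ ^ 2)
    simp only [finrank_euclideanSpace_fin] at h
    show (∫⁻ y, ‖γ • v (x₀ + γ • y)‖ₑ ^ 2) < ⊤
    rw [h, hγv]
    exact ENNReal.mul_lt_top ENNReal.ofReal_lt_top (ENNReal.mul_lt_top ENNReal.ofReal_lt_top hE)
  -- `∫ ‖w‖² = I / γ`
  have hwI : ∫ y, ‖w y‖ ^ 2 = I / γ := by
    have h1 : ∫ y, ‖w y‖ ^ 2 = ∫ y : EuclideanSpace ℝ (Fin 3),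
        (fun z : EuclideanSpace ℝ (Fin 3) => ‖γ • v (x₀ + z)‖ ^ 2) (γ • y) := rfl
    have h2 : ∫ z : EuclideanSpace ℝ (Fin 3), ‖γ • v (x₀ + z)‖ ^ 2 = γ ^ 2 * I := by
      have h := integral_add_left_eq_self (μ := volume)
        (fun z : EuclideanSpace ℝ (Fin 3) => ‖γ • v z‖ ^ 2) x₀
      rw [h, hI, ← integral_const_mul]
      refine integral_congr_ae (Eventually.of_forall fun z => ?_)
      simp only [norm_smul, Real.norm_eq_abs, abs_of_pos hγ, mul_pow]
    rw [h1, Measure.integral_comp_smul volume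
      (fun z : EuclideanSpace ℝ (Fin 3) => ‖γ • v (x₀ + z)‖ ^ 2) γ]
    simp only [finrank_euclideanSpace_fin, smul_eq_mul]
    rw [h2, abs_of_pos (by positivity)]
    field_simp
  -- bounds on the unit ball
  have hM₀ : ∀ y ∈ closedBall (0 : EuclideanSpace ℝ (Fin 3)) 1, ‖w y‖ ≤ γ * δ := by
    intro y hy
    have hγy : ‖γ • y‖ ≤ γ := by
      rw [norm_smul, Real.norm_eq_abs, abs_of_pos hγ]
      exact mul_le_of_le_one_right hγ.le (mem_closedBall_zero_iff.1 hy)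
    have hx : ‖x₀‖ ≤ ‖x₀ + γ • y‖ + ‖γ • y‖ := by
      have h := norm_sub_le (x₀ + γ • y) (γ • y)
      rwa [add_sub_cancel_right] at h
    have hfar : R < ‖x₀ + γ • y‖ := by linarith
    show ‖γ • v (x₀ + γ • y)‖ ≤ γ * δ
    rw [norm_smul, Real.norm_eq_abs, abs_of_pos hγ]
    exact mul_le_mul_of_nonneg_left (hR _ hfar).le hγ.le
  have hM₁ : ∀ y ∈ closedBall (0 : EuclideanSpace ℝ (Fin 3)) 1, ‖fderiv ℝ w y‖ ≤ γ ^ 2 * L := by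
    intro y _
    have hAd : HasFDerivAt (fun y : EuclideanSpace ℝ (Fin 3) => x₀ + γ • y)
        (γ • ContinuousLinearMap.id ℝ (EuclideanSpace ℝ (Fin 3))) y :=
      ((hasFDerivAt_id y).const_smul γ).const_add x₀
    have hvd : HasFDerivAt v (fderiv ℝ v (x₀ + γ • y)) (x₀ + γ • y) :=
      ((hv.differentiable one_ne_zero) _).hasFDerivAt
    have hwd : HasFDerivAt w
        (γ • ((fderiv ℝ v (x₀ + γ • y)).comp
          (γ • ContinuousLinearMap.id ℝ (EuclideanSpace ℝ (Fin 3))))) y :=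
      (hvd.comp y hAd).const_smul γ
    rw [hwd.fderiv, norm_smul, Real.norm_eq_abs, abs_of_pos hγ]
    calc γ * ‖(fderiv ℝ v (x₀ + γ • y)).comp
          (γ • ContinuousLinearMap.id ℝ (EuclideanSpace ℝ (Fin 3)))‖ ≤ γ * (L * γ) := by
          refine mul_le_mul_of_nonneg_left ((ContinuousLinearMap.opNorm_comp_le _ _).trans ?_) hγ.le
          refine mul_le_mul (norm_fderiv_le_of_lipschitz ℝ hlip) ?_ (norm_nonneg _) hL0
          rw [norm_smul, Real.norm_eq_abs, abs_of_pos hγ]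
          exact mul_le_of_le_one_right hγ.le ContinuousLinearMap.norm_id_le
      _ = γ ^ 2 * L := by ring
  -- the sup bound for `w` at the origin, rescaled
  have hbd := abs_normalisedPressure_le_of_local_bounds hw1 hwE 0 hM₀ hM₁
  have hsc : normalisedPressure w 0 = γ ^ 2 * normalisedPressure v x₀ := by
    have h := normalisedPressure_smul_comp_affine v x₀ γ hγ (0 : EuclideanSpace ℝ (Fin 3))
    rw [smul_zero, add_zero] at h
    exact h
  rw [hwI, hsc, abs_mul, abs_of_pos (by positivity : (0 : ℝ) < γ ^ 2)] at hbd
  have hγne : γ ≠ 0 := hγ.ne'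
  have hP : |normalisedPressure v x₀| ≤ δ ^ 2 / 3 + 8 * γ * L * δ + I / (2 * Real.pi * γ ^ 3) := by
    refine le_of_mul_le_mul_left (hbd.trans_eq ?_) (by positivity : (0 : ℝ) < γ ^ 2)
    field_simp
  have hδsq : δ ^ 2 / 3 + 8 * γ * L * δ ≤ δ * K := by
    rw [hK]
    nlinarith [hδ0, hδ1, mul_nonneg hγ.le hL0]
  calc |normalisedPressure v x₀|
      ≤ δ ^ 2 / 3 + 8 * γ * L * δ + I / (2 * Real.pi * γ ^ 3) := hP
    _ ≤ δ * K + ε / 3 := add_le_add hδsq hγI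
    _ < ε := by linarith

/-- Finite energy of a slice from the order-zero Sobolev bound. [folklore] -/
theorem lintegral_enorm_sq_lt_top_of_sobolev {S : Set ℝ} (hB : HasBoundedSobolevNormsOn S u)
    {t : ℝ} (ht : t ∈ S) : (∫⁻ x, ‖u t x‖ₑ ^ 2) < ⊤ := by
  obtain ⟨C, hC⟩ := hB 0
  refine lt_of_le_of_lt (le_of_eq (lintegral_congr fun x => ?_))
    ((hC t ht).trans_lt ENNReal.coe_lt_top)
  rw [← ofReal_norm, ← ofReal_norm, norm_iteratedFDeriv_zero]

/-- **On Tao's class the pressure IS the normalised pressure, at every time of `[0, T)`.** For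
`(u, q)` in Tao's class on `[0, T]`, `q(t) = p̃[u(t)]` for every `t ∈ [0, T)`: the difference is
harmonic (`Δq(t) = |ω|² − |∇u|²_F = −tr((∇u)²) = Δp̃[u(t)]`) and square integrable
(`q(t) ∈ H⁰`, `p̃[u(t)] ∈ L²` by Stein's bound from `u(t) ∈ L² ∩ L^∞ ⊂ L⁴`), hence zero.
[cite: Tao2011, Lemma 4.1 (i)] -/
theorem tao_pressure_eq_normalisedPressure
    {u₀ : EuclideanSpace ℝ (Fin 3) → EuclideanSpace ℝ (Fin 3)} (hq : IsTaoSolutionOn T ν u₀ u q)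
    {t : ℝ} (ht : t ∈ Ico 0 T) : q t = normalisedPressure (u t) := by
  have ht' : t ∈ Icc 0 T := Ico_subset_Icc_self ht
  have hcl := hq.classical
  have hu := hcl.contDiff_velocity ht'
  have hE : (∫⁻ x, ‖u t x‖ₑ ^ 2) < ⊤ := lintegral_enorm_sq_lt_top_of_sobolev hq.sobolev ht'
  have hdiv : VectorCalculus.IsDivFree (u t) := hcl.divFree t ht'
  -- the normalised pressure: `C²`, Laplacian `-tr((∇u)²)`
  have hP := laplacian_normalisedPressure_holds (u t) hu hE
  have hΔP : ∀ x, Δ (normalisedPressure (u t)) x =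
      -traceCLM ((fderiv ℝ (u t) x).comp (fderiv ℝ (u t) x)) := by
    intro x
    rw [laplacian_normalisedPressure_holds.of_isDivFree hu hE hdiv x,
      divergence_convect_self_eq (hu.of_le (by norm_cast)) hdiv x]
  -- the Tao pressure: smooth, same Laplacian
  have hclI : IsClassicalNSSolutionOn (Ico 0 T) ν 0 u q :=
    hcl.mono Ico_subset_Icc_self (uniqueDiffOn_Ico 0 T)
  have hΔq : ∀ x, Δ (q t) x = -traceCLM ((fderiv ℝ (u t) x).comp (fderiv ℝ (u t) x)) := by
    intro x
    rw [laplacian_pressure_eq_of_mem_Ico hclI ht x, frobeniusNormSq_fderiv_eq_sq_norm_curl_add_trace]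
    ring
  have hqs : ContDiff ℝ 2 (q t) := (hcl.contDiff_pressure ht').of_le (by norm_cast)
  -- the difference is harmonic
  have hh2 : ContDiff ℝ 2 (q t - normalisedPressure (u t)) := hqs.sub hP.1
  have hΔh : ∀ x, Δ (q t - normalisedPressure (u t)) x = 0 := by
    intro x
    rw [ContDiffAt.laplacian_sub hqs.contDiffAt hP.1.contDiffAt, hΔq x, hΔP x, sub_self]
  have hharm : HarmonicOnNhd (q t - normalisedPressure (u t)) univ :=
    harmonicOnNhd_of_laplacian_eq_zero hh2 hΔh
  -- both are square integrable
  obtain ⟨B, -, hB⟩ := hq.sobolev.exists_forall_norm_iteratedFDeriv_le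
    (fun s hs => hcl.contDiff_velocity hs) 0
  have hbd : ∀ x, ‖u t x‖ ≤ B := fun x => by
    have h := hB t ht' x
    rwa [norm_iteratedFDeriv_zero] at h
  have hu4 : MemLp (u t) (2 * 2) volume := by
    rw [show (2 : ℝ≥0∞) * 2 = 4 by norm_num]
    exact memLp_four_of_norm_le hu.continuous hE hbd
  have hPL2 : MemLp (normalisedPressure (u t)) 2 volume :=
    memLp_normalisedPressure_of_memLp_two_mul (by norm_num) (by norm_num) hu4
  have hqL2 : MemLp (q t) 2 volume := by
    obtain ⟨C, hC⟩ := hq.sobolev_p 0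
    have hlt : (∫⁻ x, ‖q t x‖ₑ ^ 2) < ⊤ := by
      refine lt_of_le_of_lt (le_of_eq (lintegral_congr fun x => ?_))
        ((hC t ht').trans_lt ENNReal.coe_lt_top)
      rw [← ofReal_norm, ← ofReal_norm, norm_iteratedFDeriv_zero]
    refine ⟨hqs.continuous.aestronglyMeasurable, ?_⟩
    rw [eLpNorm_lt_top_iff_lintegral_rpow_enorm_lt_top two_ne_zero (by simp)]
    have h2r : (2 : ℝ≥0∞).toReal = ((2 : ℕ) : ℝ) := by norm_num
    simp_rw [h2r, ENNReal.rpow_natCast]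
    exact hlt
  have hzero := eq_zero_of_harmonic_memLp hharm (q := 2) (by norm_num) (by simp) (hqL2.sub hPL2)
  exact sub_eq_zero.1 hzero

/-- **Pressure gauge.** For a classical Leray–Hopf solution of unforced Navier–Stokes on `[0, T)`
(`ν > 0`) from a rapidly decaying datum and every `t ∈ [0, T)`, the pressure is the normalised
pressure up to a constant: `p(t, ·) = p̃[u(t)] + c(t)`. Tao's theory gives a pressure `q` with
`(u, q)` in his class on `[0, (t+T)/2]`; `∇p = ∇q` from the two momentum equations, and
`q(t) = p̃[u(t)]` (`tao_pressure_eq_normalisedPressure`). [cite: Tao2011, Lemma 4.1 (i)] -/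
theorem pressure_eq_normalisedPressure_add_const (hν : 0 < ν)
    (hsol : IsClassicalNSSolutionOn (Ico 0 T) ν 0 u p) (hLH : IsLerayHopfOn T ν 0 (u 0) u)
    (hdec : HasRapidSpatialDecay (u 0)) {t : ℝ} (ht : t ∈ Ico 0 T) :
    ∃ c : ℝ, ∀ x, p t x = normalisedPressure (u t) x + c := by
  -- a closed sub-slab `[0, T']` through `t`
  set T' : ℝ := (t + T) / 2 with hT'
  have htT' : t < T' := by rw [hT']; linarith [ht.2]
  have hT'T : T' < T := by rw [hT']; linarith [ht.2]
  have hT'0 : 0 < T' := lt_of_le_of_lt ht.1 htT'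
  have ht' : t ∈ Icc 0 T' := ⟨ht.1, htT'.le⟩
  have hsolc : IsClassicalNSSolutionOn (Icc 0 T') ν 0 u p :=
    hsol.mono (Icc_subset_Ico_right hT'T) (uniqueDiffOn_Icc hT'0)
  have hEn : ∃ C : ℝ≥0, ∀ s ∈ Icc 0 T', ∫⁻ x, ‖u s x‖ₑ ^ 2 ≤ C :=
    ⟨(2 * VectorCalculus.kineticEnergy (u 0)).toNNReal, fun s hs =>
      hLH.lintegral_enorm_sq_le hν.le ⟨hs.1, hs.2.trans hT'T.le⟩⟩
  have hB : HasBoundedSobolevNormsOn (Icc 0 T') u :=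
    tao2011_hasBoundedSobolevNormsOn_holds hν hT'0 hsolc hEn hdec
  obtain ⟨q, hq⟩ := RungReynoldsOne.exists_isTaoSolutionOn_of_hasBoundedSobolevNormsOn hν hT'0 hsolc hB
  -- `∇p = ∇q`: the same velocity in the two momentum equations
  have hgrad : ∀ x, fderiv ℝ (p t) x = fderiv ℝ (q t) x := by
    intro x
    have h := (hsolc.momentum t ht' x).symm.trans (hq.classical.momentum t ht' x)
    rw [add_left_inj, sub_right_inj] at h
    unfold gradient at h
    exact (InnerProductSpace.toDual ℝ _).symm.injective h
  have hpd : Differentiable ℝ (p t) := (hsolc.contDiff_pressure ht').differentiable (by simp)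
  have hqd : Differentiable ℝ (q t) :=
    (hq.classical.contDiff_pressure ht').differentiable (by simp)
  have hconst : ∀ x, p t x - q t x = p t 0 - q t 0 := by
    intro x
    refine is_const_of_fderiv_eq_zero (hpd.sub hqd) (fun y => ?_) x 0
    rw [fderiv_sub (hpd y) (hqd y), hgrad y, sub_self]
  -- `q(t) = p̃[u(t)]`
  have hqt : q t = normalisedPressure (u t) :=
    tao_pressure_eq_normalisedPressure hq ⟨ht.1, htT'⟩
  refine ⟨p t 0 - q t 0, fun x => ?_⟩
  rw [← hconst x, hqt]
  ring

end HeadPeaks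

/-- **Item stmt-NavierStokesRegularity-3037** (`BernoulliDeceleration.HeadPeaksDecelerate`): for a
classical Leray–Hopf solution of unforced Navier–Stokes on `[0, T) × ℝ³` (`ν > 0`) from a rapidly
decaying datum, whenever the modified head `Π̃(t, ·) = |u|²/2 + p̃[u(t)]` is positive somewhere it
attains its maximum at a point `y` with `∂ₜ|u|²(t, y) ≤ −2ν|ω(t, y)|²`. [cite: SereginSverak2002, §1] -/
theorem bernoulliDeceleration_headPeaksDecelerate_proof :
    Summit.NavierStokesRegularity.NavierStokesRegularity.Theses.BernoulliDeceleration.HeadPeaksDecelerate := by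
  intro ν T hν hT u p hsol hLH hdec t ht x hx
  -- the slice `u(t)`: smooth, finite energy, Lipschitz
  have hu := hsol.contDiff_velocity ht
  have hE : (∫⁻ y, ‖u t y‖ₑ ^ 2) < ⊤ :=
    (hLH.lintegral_enorm_sq_le hν.le ⟨ht.1, ht.2.le⟩).trans_lt ENNReal.ofReal_lt_top
  obtain ⟨B, -, hBlip⟩ := EndpointMap.slab_bounds hν hsol hLH hdec (T' := (t + T) / 2)
    ⟨by linarith [ht.1, ht.2], by linarith [ht.2]⟩
  have hlip : LipschitzWith B (u t) := hBlip t ⟨ht.1, by linarith [ht.2]⟩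
  have hv2 : Integrable fun y => ‖u t y‖ ^ 2 :=
    integrable_sq_of_lintegral_enorm_sq_lt_top hu.continuous hE
  -- the modified head is continuous and tends to `0` at infinity
  set Ph : EuclideanSpace ℝ (Fin 3) → ℝ := fun y => ‖u t y‖ ^ 2 / 2 + normalisedPressure (u t) y
    with hPh
  have hPhc : Continuous Ph :=
    ((hu.continuous.norm.pow 2).div_const 2).add (SereginSverak2002.continuous_normalisedPressure_of_integrable hu hv2)
  have hu0 : Tendsto (u t) (cocompact _) (𝓝 0) :=
    tendsto_cocompact_of_lipschitzWith_of_integrable_sq hlip hv2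
  have hP0 := HeadPeaks.tendsto_normalisedPressure_cocompact (hu.of_le (by norm_cast)) hE hlip
  have hPh0 : Tendsto Ph (cocompact _) (𝓝 0) := by
    have h := ((hu0.norm.pow 2).div_const 2).add hP0
    simpa using h
  -- a global maximiser of the modified head
  obtain ⟨y, hy⟩ : ∃ y, ∀ z, Ph z ≤ Ph y := by
    refine hPhc.exists_forall_ge' x ?_
    exact ((tendsto_order.1 hPh0).2 _ hx).mono fun z hz => hz.le
  -- the pressure gauge: `p(t) = p̃[u(t)] + c`
  obtain ⟨c, hc⟩ := HeadPeaks.pressure_eq_normalisedPressure_add_const hν hsol hLH hdec ht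
  have hmax : IsLocalMax (fun z => ‖u t z‖ ^ 2 / 2 + p t z) y := by
    refine Filter.Eventually.of_forall fun z => ?_
    have h := hy z
    simp only [hPh] at h
    show ‖u t z‖ ^ 2 / 2 + p t z ≤ ‖u t y‖ ^ 2 / 2 + p t y
    rw [hc z, hc y]
    linarith
  exact ⟨y, bernoulliDeceleration_headMaxPointLemma_proof ν T hν.le u p hsol t ht y hmax, hy x⟩

end Summit.NavierStokesRegularity.NavierStokesRegularity.Theorems

end
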